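import Literature.Analysis.UnboundedOperators.LinearizedBoltzmannKernelActionPointwise
import Literature.Analysis.UnboundedOperators.LinearizedBoltzmannKernelAction
import Literature.Analysis.UnboundedOperators.LinearizedBoltzmannGaussGrowth
import Literature.Analysis.UnboundedOperators.LinearizedBoltzmannBoundedInverse
import HarnessLib

/-!
# The pointwise Chapman–Enskog inverse of the linearised hard-sphere operator in `ℝ³`

For the linearised hard-sphere operator `L` around the normalised Maxwellian on
`ℝ³ = EuclideanSpace ℝ (Fin 3)` (`LinearizedBoltzmann.lean`) we upgrade the `L²(M dv)` inverse of
`LinearizedBoltzmannBoundedInverse` (Lax–Milgram + spectral gap) to an **everywhere-defined**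
solution (`exists_pointwise_inverse_hardSphereLinearizedOp`): there are absolute constants `λ > 0`,
`C₀ > 0` such that for every bounded measurable `g` (`|g| ≤ b`) which is `M`-orthogonal to the
collision invariants there is a measurable `ψ₀` with the Gaussian growth bound
`|ψ₀(v)| ≤ C₀ b e^{|v|²/4}`, in `L²(M dv)` with `λ ‖ψ₀‖ ≤ ‖g‖`, `M`-orthogonal to the collision
invariants, with `ν ψ₀ = K ψ₀ - g` pointwise and **`L ψ₀ (v) = g(v)` at every `v`** (CIP 1994 §7.2).
Ingredients: `ψ₀ := ν⁻¹ (K u - g)` for the `L²`-solution `u`, where `K` is Grad's kernel part as an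
everywhere convergent integral (`exists_abs_kernelAction_le_exp`: the Gaussian growth
`|K u (v)| ≤ K₀ ‖u‖ e^{|v|²/4}` for `u ∈ L²(M dv)` in `ℝ³`, from the Carleman/Grad bound and the
exchange symmetry), `K u = gainLossOp u` a.e. (`coeFn_gainLossOp_ae_eq_kernelAction`), `K` sees
only a.e.-classes at every velocity (`kernelAction_eq_of_ae_eq`), and Grad's splitting under
Gaussian growth (`hardSphereLinearizedOp_eq_kernel_sub_of_gaussGrowth`). Continuity of `ψ₀` follows
in `LinearizedBoltzmannChapmanEnskogInverse.lean`; the sup-norm bound `‖ψ₀‖_∞ ≤ C ‖g‖_∞` (the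
borderline Maxwellian weight of Grad's `L^∞` theory) is NOT proved. No new definitions.
-/

open MeasureTheory Metric Real Set Filter Topology ProbabilityTheory Module
open scoped InnerProductSpace ENNReal

namespace Literature.Analysis.UnboundedOperators

noncomputable section

open Literature.MathematicalPhysics.KineticTheory (collide sphereMeasure hardSphereKernel carlemanKernel
  gradRadial lintegral_lintegral_hardSphere_gain_exchange carlemanKernel_nonneg)
open Literature.Analysis.FluidPDE

/-! ### Gaussian growth of the kernel action of an `L²(M dv)` function in `ℝ³` -/

/-- **Gaussian growth of the kernel action in `ℝ³`**: for measurable `u ∈ L²(M dv)` there is `C`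
with `|∫∫ ((v - v_*)·ω)₊ (u(v') + u(v_*') - u(v_*)) dω dM(v_*)| ≤ C e^{|v|²/4}` for **every** `v` (the
two gain integrals by the Carleman/Grad bound `lintegral_gain_fst_enorm_le` and the exchange
symmetry, the loss integral by Cauchy–Schwarz). [folklore] -/
theorem exists_abs_kernelAction_le_exp :
    ∃ K : ℝ, 0 ≤ K ∧ ∀ (u : EuclideanSpace ℝ (Fin 3) → ℝ), Measurable u →
      MemLp u 2 (stdGaussian (EuclideanSpace ℝ (Fin 3))) →
      ∀ v, |∫ w, ∫ ω, hardSphereKernel (v, w) ω *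
        (u (collide ω (v, w)).1 + u (collide ω (v, w)).2 - u w) ∂sphereMeasure
          ∂stdGaussian (EuclideanSpace ℝ (Fin 3))| ≤
        K * (eLpNorm u 2 (stdGaussian (EuclideanSpace ℝ (Fin 3)))).toReal * Real.exp (‖v‖ ^ 2 / 4) := by
  haveI := isFiniteMeasure_sphereMeasure (E := EuclideanSpace ℝ (Fin 3))
  -- the finite constants
  set CG : ℝ≥0∞ := (∫⁻ x : EuclideanSpace ℝ (Fin 3), ENNReal.ofReal (gradRadial 1 x ^ 2)) ^ (1 / 2 : ℝ)
    with hCG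
  have hCGt : CG ≠ ∞ := ENNReal.rpow_ne_top_of_nonneg (by norm_num) lintegral_gradRadial_sq_lt_top.ne
  set m : ℝ≥0∞ := (∫⁻ w, ENNReal.ofReal ((1 + ‖w‖) ^ 2) ∂stdGaussian (EuclideanSpace ℝ (Fin 3))) ^ (1 / 2 : ℝ)
    with hm
  have hmt : m ≠ ∞ := by
    refine ENNReal.rpow_ne_top_of_nonneg (by norm_num) ?_
    have h := (integrable_one_add_norm_pow_stdGaussian (E := EuclideanSpace ℝ (Fin 3)) 2).lintegral_lt_top
    exact h.ne
  set S : ℝ := (sphereMeasure : Measure (sphere (0 : EuclideanSpace ℝ (Fin 3)) 1)).real univ with hS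
  have hS0 : 0 ≤ S := measureReal_nonneg
  set A : ℝ := (Real.sqrt (globalMaxwellian (0 : EuclideanSpace ℝ (Fin 3))))⁻¹ with hA
  have hA0 : 0 ≤ A := inv_nonneg.2 (Real.sqrt_nonneg _)
  -- the candidate constant
  refine ⟨2 * A * CG.toReal + 2 * S * m.toReal, by positivity, fun u hum hu v => ?_⟩
  set N : ℝ≥0∞ := eLpNorm u 2 (stdGaussian (EuclideanSpace ℝ (Fin 3))) with hN
  have hNt : N ≠ ∞ := hu.eLpNorm_ne_top
  have hev : 1 ≤ Real.exp (‖v‖ ^ 2 / 4) := Real.one_le_exp (by positivity)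
  have h1v : 1 + ‖v‖ ≤ 2 * Real.exp (‖v‖ ^ 2 / 4) := by
    have h2 : 1 + ‖v‖ ^ 2 / 4 ≤ Real.exp (‖v‖ ^ 2 / 4) := by linarith [Real.add_one_le_exp (‖v‖ ^ 2 / 4)]
    nlinarith [sq_nonneg (‖v‖ - 2), norm_nonneg v]
  -- the three pieces
  have hc1 : Measurable fun p : EuclideanSpace ℝ (Fin 3) × sphere (0 : EuclideanSpace ℝ (Fin 3)) 1 =>
      (collide p.2 (v, p.1)).1 := by
    have : Continuous fun p : EuclideanSpace ℝ (Fin 3) × sphere (0 : EuclideanSpace ℝ (Fin 3)) 1 =>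
        (collide p.2 (v, p.1)).1 := by unfold collide; fun_prop
    exact this.measurable
  have hc2 : Measurable fun p : EuclideanSpace ℝ (Fin 3) × sphere (0 : EuclideanSpace ℝ (Fin 3)) 1 =>
      (collide p.2 (v, p.1)).2 := by
    have : Continuous fun p : EuclideanSpace ℝ (Fin 3) × sphere (0 : EuclideanSpace ℝ (Fin 3)) 1 =>
        (collide p.2 (v, p.1)).2 := by unfold collide; fun_prop
    exact this.measurable
  have I1 : ∫⁻ w, ∫⁻ ω, ENNReal.ofReal (hardSphereKernel (v, w) ω) * ‖u (collide ω (v, w)).1‖ₑ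
      ∂sphereMeasure ∂stdGaussian (EuclideanSpace ℝ (Fin 3)) ≤
      ENNReal.ofReal (A * Real.exp (‖v‖ ^ 2 / 4)) * (CG * N) := by
    rw [lintegral_stdGaussian_kernel_eq_volume (U := fun p => ‖u (collide p.2 (v, p.1)).1‖ₑ)
      ((hum.comp hc1).enorm) v, ← inv_sqrt_globalMaxwellian v]
    exact lintegral_gain_fst_enorm_le v hum
  have I2 : ∫⁻ w, ∫⁻ ω, ENNReal.ofReal (hardSphereKernel (v, w) ω) * ‖u (collide ω (v, w)).2‖ₑ
      ∂sphereMeasure ∂stdGaussian (EuclideanSpace ℝ (Fin 3)) ≤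
      ENNReal.ofReal (A * Real.exp (‖v‖ ^ 2 / 4)) * (CG * N) := by
    rw [lintegral_stdGaussian_kernel_eq_volume (U := fun p => ‖u (collide p.2 (v, p.1)).2‖ₑ)
      ((hum.comp hc2).enorm) v,
      lintegral_lintegral_hardSphere_gain_exchange v globalMaxwellian volume hum.enorm,
      ← inv_sqrt_globalMaxwellian v]
    exact lintegral_gain_fst_enorm_le v hum
  have I3 : ∫⁻ w, ∫⁻ ω, ENNReal.ofReal (hardSphereKernel (v, w) ω) * ‖u w‖ₑ
      ∂sphereMeasure ∂stdGaussian (EuclideanSpace ℝ (Fin 3)) ≤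
      ENNReal.ofReal (S * (2 * Real.exp (‖v‖ ^ 2 / 4))) * (m * N) := by
    refine (lintegral_loss_enorm_le hum v).trans ?_
    rw [← hS]
    exact mul_le_mul' (ENNReal.ofReal_le_ofReal (mul_le_mul_of_nonneg_left h1v hS0)) le_rfl
  have htot := (enorm_kernelAction_le_add hum v).trans (add_le_add (add_le_add I1 I2) I3)
  -- pass to real numbers
  have hfin : ENNReal.ofReal (A * Real.exp (‖v‖ ^ 2 / 4)) * (CG * N) +
      ENNReal.ofReal (A * Real.exp (‖v‖ ^ 2 / 4)) * (CG * N) +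
      ENNReal.ofReal (S * (2 * Real.exp (‖v‖ ^ 2 / 4))) * (m * N) ≠ ∞ := by
    have h1 : ENNReal.ofReal (A * Real.exp (‖v‖ ^ 2 / 4)) * (CG * N) ≠ ∞ :=
      ENNReal.mul_ne_top ENNReal.ofReal_ne_top (ENNReal.mul_ne_top hCGt hNt)
    exact ENNReal.add_ne_top.2 ⟨ENNReal.add_ne_top.2 ⟨h1, h1⟩,
      ENNReal.mul_ne_top ENNReal.ofReal_ne_top (ENNReal.mul_ne_top hmt hNt)⟩
  have habs : |∫ w, ∫ ω, hardSphereKernel (v, w) ω *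
        (u (collide ω (v, w)).1 + u (collide ω (v, w)).2 - u w) ∂sphereMeasure
          ∂stdGaussian (EuclideanSpace ℝ (Fin 3))| = (‖∫ w, ∫ ω, hardSphereKernel (v, w) ω *
        (u (collide ω (v, w)).1 + u (collide ω (v, w)).2 - u w) ∂sphereMeasure
          ∂stdGaussian (EuclideanSpace ℝ (Fin 3))‖ₑ).toReal := by
    rw [Real.enorm_eq_ofReal_abs, ENNReal.toReal_ofReal (abs_nonneg _)]
  rw [habs]
  refine (ENNReal.toReal_mono hfin htot).trans (le_of_eq ?_)
  have hT1 : (ENNReal.ofReal (A * Real.exp (‖v‖ ^ 2 / 4)) * (CG * N)).toReal =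
      A * Real.exp (‖v‖ ^ 2 / 4) * (CG * N).toReal := by
    rw [ENNReal.toReal_mul, ENNReal.toReal_ofReal (by positivity)]
  have hT3 : (ENNReal.ofReal (S * (2 * Real.exp (‖v‖ ^ 2 / 4))) * (m * N)).toReal =
      S * (2 * Real.exp (‖v‖ ^ 2 / 4)) * (m * N).toReal := by
    rw [ENNReal.toReal_mul, ENNReal.toReal_ofReal (by positivity)]
  have hne1 : ENNReal.ofReal (A * Real.exp (‖v‖ ^ 2 / 4)) * (CG * N) ≠ ∞ :=
    ENNReal.mul_ne_top ENNReal.ofReal_ne_top (ENNReal.mul_ne_top hCGt hNt)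
  have hne3 : ENNReal.ofReal (S * (2 * Real.exp (‖v‖ ^ 2 / 4))) * (m * N) ≠ ∞ :=
    ENNReal.mul_ne_top ENNReal.ofReal_ne_top (ENNReal.mul_ne_top hmt hNt)
  rw [ENNReal.toReal_add (ENNReal.add_ne_top.2 ⟨hne1, hne1⟩) hne3, ENNReal.toReal_add hne1 hne1, hT1, hT3,
    ENNReal.toReal_mul, ENNReal.toReal_mul]
  ring

/-! ### Assembly -/

/-- **The pointwise Chapman–Enskog inverse in `ℝ³`.** There is `λ > 0` (the spectral gap of the
linearised hard-sphere operator) such that for every bounded measurable `g` on `ℝ³` which is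
`M`-orthogonal to the collision invariants there is a measurable `ψ₀` of Gaussian growth
`|ψ₀(v)| ≤ C e^{|v|²/4}`, in `L²(M dv)` with `λ ‖ψ₀‖ ≤ ‖g‖` and `M`-orthogonal to the collision
invariants, which solves the integral equation `ν ψ₀ = ∫∫ B (ψ₀' + ψ₀,*' - ψ₀,*) - g` and hence
**`L ψ₀ (v) = g(v)` at every `v`** (CIP 1994 §7.2: `L h = g` is solvable iff `g ⊥` the collision
invariants; here with the everywhere-defined representative `ψ₀ = ν⁻¹ (K u - g)` of the
`L²`-solution `u`, Grad's splitting). [cite: CIPDiluteGases1994, §7.2 Thm 7.2.1 and Thm 7.2.5] -/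
theorem exists_pointwise_inverse_hardSphereLinearizedOp :
    ∃ lam C₀ : ℝ, 0 < lam ∧ 0 < C₀ ∧ ∀ (g : EuclideanSpace ℝ (Fin 3) → ℝ) (b : ℝ), Measurable g →
      (∀ v, |g v| ≤ b) →
      (∀ φ ∈ collisionInvariants (EuclideanSpace ℝ (Fin 3)), maxwellianInner g φ = 0) →
      ∃ ψ₀ : EuclideanSpace ℝ (Fin 3) → ℝ, Measurable ψ₀ ∧
        (∀ v, |ψ₀ v| ≤ C₀ * b * Real.exp (‖v‖ ^ 2 / 4)) ∧
        MemLp ψ₀ 2 (stdGaussian (EuclideanSpace ℝ (Fin 3))) ∧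
        lam * (eLpNorm ψ₀ 2 (stdGaussian (EuclideanSpace ℝ (Fin 3)))).toReal ≤
          (eLpNorm g 2 (stdGaussian (EuclideanSpace ℝ (Fin 3)))).toReal ∧
        (∀ φ ∈ collisionInvariants (EuclideanSpace ℝ (Fin 3)), maxwellianInner ψ₀ φ = 0) ∧
        (∀ v, collisionFrequency v * ψ₀ v =
          (∫ w, ∫ ω, hardSphereKernel (v, w) ω * (ψ₀ (collide ω (v, w)).1 + ψ₀ (collide ω (v, w)).2 - ψ₀ w)
            ∂sphereMeasure ∂stdGaussian (EuclideanSpace ℝ (Fin 3))) - g v) ∧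
        ∀ v, hardSphereLinearizedOp ψ₀ v = g v := by
  have hE : 2 ≤ finrank ℝ (EuclideanSpace ℝ (Fin 3)) := by simp
  have hE0 : 0 < finrank ℝ (EuclideanSpace ℝ (Fin 3)) := by simp
  obtain ⟨lam, hlam, hinv⟩ := exists_gap_and_inverse_linearizedHardSpherePMap (E := EuclideanSpace ℝ (Fin 3)) hE
  obtain ⟨ν₀, hν₀, hν₀le⟩ := exists_pos_le_collisionFrequency (E := EuclideanSpace ℝ (Fin 3)) hE0
  have hνpos := (collisionFrequency_pos_and_continuous (E := EuclideanSpace ℝ (Fin 3)) hE0).1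
  obtain ⟨K, hK0, hK⟩ := exists_abs_kernelAction_le_exp
  refine ⟨lam, ν₀⁻¹ * (K * lam⁻¹ + 1), hlam, by positivity, fun g b hgm hb horth => ?_⟩
  have hb0 : 0 ≤ b := (abs_nonneg _).trans (hb 0)
  have hg2 : MemLp g 2 (stdGaussian (EuclideanSpace ℝ (Fin 3))) :=
    memLp_two_of_abs_le_pow hgm.aestronglyMeasurable (C := b) (m := 0) fun v => by simpa using hb v
  -- `‖g‖_{L²(M)} ≤ b`
  have hgnorm : (eLpNorm g 2 (stdGaussian (EuclideanSpace ℝ (Fin 3)))).toReal ≤ b := by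
    have h := eLpNorm_le_of_ae_bound (p := 2) (μ := stdGaussian (EuclideanSpace ℝ (Fin 3))) (f := g) (C := b)
      (Eventually.of_forall fun v => by rw [Real.norm_eq_abs]; exact hb v)
    simp only [measure_univ, ENNReal.one_rpow, one_mul] at h
    exact (ENNReal.toReal_mono ENNReal.ofReal_ne_top h).trans (by rw [ENNReal.toReal_ofReal hb0])
  obtain ⟨u, hAu, huorth, hubound⟩ := hinv g hg2 horth
  -- the representative of the `L²` solution and its kernel action
  set ut : EuclideanSpace ℝ (Fin 3) → ℝ := ((u : Lp ℝ 2 (stdGaussian (EuclideanSpace ℝ (Fin 3)))) :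
    EuclideanSpace ℝ (Fin 3) → ℝ) with hut
  have hutm : Measurable ut := (Lp.stronglyMeasurable _).measurable
  have hut2 : MemLp ut 2 (stdGaussian (EuclideanSpace ℝ (Fin 3))) := Lp.memLp _
  -- `‖u‖ ≤ b / λ`
  have hunorm : (eLpNorm ut 2 (stdGaussian (EuclideanSpace ℝ (Fin 3)))).toReal ≤ lam⁻¹ * b := by
    have h1 : (eLpNorm ut 2 (stdGaussian (EuclideanSpace ℝ (Fin 3)))).toReal =
        ‖(u : Lp ℝ 2 (stdGaussian (EuclideanSpace ℝ (Fin 3))))‖ := (Lp.norm_def _).symm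
    rw [h1, le_inv_mul_iff₀' hlam]
    calc ‖(u : Lp ℝ 2 (stdGaussian (EuclideanSpace ℝ (Fin 3))))‖ * lam
        = lam * ‖(u : Lp ℝ 2 (stdGaussian (EuclideanSpace ℝ (Fin 3))))‖ := mul_comm _ _
      _ ≤ ‖hg2.toLp g‖ := hubound
      _ = (eLpNorm g 2 (stdGaussian (EuclideanSpace ℝ (Fin 3)))).toReal := Lp.norm_toLp g hg2
      _ ≤ b := hgnorm
  have hC₁ : ∀ v, |∫ w, ∫ ω, hardSphereKernel (v, w) ω *
      (ut (collide ω (v, w)).1 + ut (collide ω (v, w)).2 - ut w) ∂sphereMeasure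
        ∂stdGaussian (EuclideanSpace ℝ (Fin 3))| ≤ K * (lam⁻¹ * b) * Real.exp (‖v‖ ^ 2 / 4) := fun v =>
    (hK ut hutm hut2 v).trans (mul_le_mul_of_nonneg_right (mul_le_mul_of_nonneg_left hunorm hK0)
      (Real.exp_nonneg _))
  set C₁ : ℝ := K * (lam⁻¹ * b) with hC₁def
  -- the candidate
  set ψ₀ : EuclideanSpace ℝ (Fin 3) → ℝ := fun v => (collisionFrequency v)⁻¹ *
    ((∫ w, ∫ ω, hardSphereKernel (v, w) ω * (ut (collide ω (v, w)).1 + ut (collide ω (v, w)).2 - ut w)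
      ∂sphereMeasure ∂stdGaussian (EuclideanSpace ℝ (Fin 3))) - g v) with hψ₀
  have hψ₀m : Measurable ψ₀ :=
    measurable_collisionFrequency.inv.mul
      ((stronglyMeasurable_kernelAction_of_measurable hutm).measurable.sub hgm)
  -- Gaussian growth
  have hC₁b : ν₀⁻¹ * (C₁ + b) = ν₀⁻¹ * (K * lam⁻¹ + 1) * b := by rw [hC₁def]; ring
  have hgrowth : ∀ v, |ψ₀ v| ≤ ν₀⁻¹ * (C₁ + b) * Real.exp (‖v‖ ^ 2 / 4) := by
    intro v
    have hev : 1 ≤ Real.exp (‖v‖ ^ 2 / 4) := Real.one_le_exp (by positivity)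
    have hν := hν₀le v
    have h1 := hC₁ v
    have h2 := hb v
    simp only [hψ₀]
    rw [abs_mul, abs_inv, abs_of_pos (hνpos v)]
    have hinv : (collisionFrequency v)⁻¹ ≤ ν₀⁻¹ := inv_anti₀ hν₀ hν
    calc (collisionFrequency v)⁻¹ * |(∫ w, ∫ ω, hardSphereKernel (v, w) ω *
          (ut (collide ω (v, w)).1 + ut (collide ω (v, w)).2 - ut w) ∂sphereMeasure
            ∂stdGaussian (EuclideanSpace ℝ (Fin 3))) - g v|
        ≤ ν₀⁻¹ * (C₁ * Real.exp (‖v‖ ^ 2 / 4) + b) :=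
          mul_le_mul hinv ((abs_sub _ _).trans (add_le_add h1 h2)) (abs_nonneg _) (by positivity)
      _ ≤ ν₀⁻¹ * (C₁ + b) * Real.exp (‖v‖ ^ 2 / 4) := by
          have : b ≤ b * Real.exp (‖v‖ ^ 2 / 4) := le_mul_of_one_le_right hb0 hev
          nlinarith [inv_pos.2 hν₀]
  -- `ψ₀ = u` almost everywhere
  have hae : ψ₀ =ᵐ[stdGaussian (EuclideanSpace ℝ (Fin 3))] ut := by
    have h1 := coeFn_gainLossOp_ae_eq_kernelAction hE (u : Lp ℝ 2 (stdGaussian (EuclideanSpace ℝ (Fin 3))))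
    have h2 : ((linearizedHardSpherePMap hE u : Lp ℝ 2 (stdGaussian (EuclideanSpace ℝ (Fin 3)))) :
        EuclideanSpace ℝ (Fin 3) → ℝ) =ᵐ[stdGaussian (EuclideanSpace ℝ (Fin 3))] g := by
      rw [hAu]; exact MemLp.coeFn_toLp hg2
    rw [linearizedHardSpherePMap_apply] at h2
    filter_upwards [h1, h2, Lp.coeFn_add (-mulFrequency u)
        (gainLossOp hE (u : Lp ℝ 2 (stdGaussian (EuclideanSpace ℝ (Fin 3))))),
      Lp.coeFn_neg (mulFrequency u), coeFn_mulFrequency u] with v hv1 hv2 hv3 hv4 hv5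
    rw [hv3, Pi.add_apply, hv4, Pi.neg_apply, hv5, hv1] at hv2
    simp only [hψ₀]
    rw [← hv2]
    field_simp [(hνpos v).ne']
    ring
  have hmem : MemLp ψ₀ 2 (stdGaussian (EuclideanSpace ℝ (Fin 3))) := hut2.ae_eq hae.symm
  have hnorm : eLpNorm ψ₀ 2 (stdGaussian (EuclideanSpace ℝ (Fin 3))) =
      eLpNorm ut 2 (stdGaussian (EuclideanSpace ℝ (Fin 3))) := eLpNorm_congr_ae hae
  -- `ψ₀ = u` Lebesgue-a.e., hence the kernel actions agree everywhere
  have haev : ψ₀ =ᵐ[volume] ut := volume_absolutelyContinuous_stdGaussian.ae_le hae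
  have hK : ∀ v, (∫ w, ∫ ω, hardSphereKernel (v, w) ω *
      (ψ₀ (collide ω (v, w)).1 + ψ₀ (collide ω (v, w)).2 - ψ₀ w) ∂sphereMeasure
        ∂stdGaussian (EuclideanSpace ℝ (Fin 3))) =
      ∫ w, ∫ ω, hardSphereKernel (v, w) ω * (ut (collide ω (v, w)).1 + ut (collide ω (v, w)).2 - ut w)
        ∂sphereMeasure ∂stdGaussian (EuclideanSpace ℝ (Fin 3)) := fun v =>
    kernelAction_eq_of_ae_eq hψ₀m hutm haev v
  have hfix : ∀ v, collisionFrequency v * ψ₀ v =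
      (∫ w, ∫ ω, hardSphereKernel (v, w) ω * (ψ₀ (collide ω (v, w)).1 + ψ₀ (collide ω (v, w)).2 - ψ₀ w)
        ∂sphereMeasure ∂stdGaussian (EuclideanSpace ℝ (Fin 3))) - g v := by
    intro v
    rw [hK v]
    simp only [hψ₀]
    rw [← mul_assoc, mul_inv_cancel₀ (hνpos v).ne', one_mul]
  refine ⟨ψ₀, hψ₀m, fun v => hC₁b ▸ hgrowth v, hmem, ?_, ?_, hfix, fun v => ?_⟩
  · -- the `L²` bound
    rw [hnorm, ← Lp.norm_def, ← Lp.norm_toLp g hg2]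
    exact hubound
  · -- orthogonality
    intro φ hφ
    rw [← huorth φ hφ, maxwellianInner, maxwellianInner]
    refine integral_congr_ae ?_
    filter_upwards [hae] with v hv
    rw [hv]
  · -- the equation at every `v`
    rw [hardSphereLinearizedOp_eq_kernel_sub_of_gaussGrowth hψ₀m hgrowth v, hfix v]
    ring

end

end Literature.Analysis.UnboundedOperators
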